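import Mathlib
import Summits.ValiantsHypothesis.ValiantsHypothesis.Theorems.RigidityForcesSymmetryRankRigidMinimalReprLaplaceResidualFibre

/-!
# Tools for CASE 2 of the residual `a = 3` configurations: the hub covector vanishing at one letter
# (crux `RankRigidMinimalRepr`, stmt-ValiantsHypothesis-18034; frontier rung `LaplaceOptimalFive`, stmt-24813)

After `laplace_five_three_slices_residual_indicator` (`…LaplaceFiveResidualIndicator.lean`) the slice vectors of a residual
configuration are letter indicators, so the hub covector `φ₀ ⊥ κ e_a` can be taken with `φ₀(a) = 0` and all OTHER coordinates
non-zero (instead of full support).  The CASE-1 injectivity step (`lemmaZ` + the `2 × 2` core) is replaced by: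

* `lemmaZ_letter` — if `φ₀(a) = 0`, `φ₀(x) ≠ 0` for `x ≠ a`, and all fibre sums (`3 × 3` permanents) of `(φ₀;φ₁;φ₂)` vanish,
  then `φ₁(a)φ₂(x) + φ₁(x)φ₂(a) = 0` for every `x ≠ a` (three triples through `a`, one `linear_combination`);
* `kernel_line_letter` — if moreover `φ₁(a) ≠ 0`, any two such `φ₂, φ₂'` are linearly dependent:
  `φ₂'(a) • φ₂ = φ₂(a) • φ₂'` (the kernel of `φ₂ ↦ M(φ₀,φ₁,φ₂)` is at most the line through the reflected `φ₁`), and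
  `φ₂(a) = 0` forces `φ₂ = 0`.

With three independent candidates in `V₂` (dim ≥ 3) this gives `M ∉ ℂ·N` exactly as in CASE 1 whenever `V₁` contains a covector
with `φ₁(a) ≠ 0` (sub-case 2a of the blueprint, evidence note NOTE-p8g11-24813 §v3/v4); the complementary sub-case 2b
(`V₁ ⊆ e_a^⊥`) is the last open piece.  No definitions.  HONEST FRAMING: infrastructure toward the frontier rung
`LaplaceOptimalFive` (stmt-24813), which stays OPEN; nothing here bears on `VP ≠ VNP`.
-/

set_option autoImplicit false

-- the mandated summit-side namespace repeats a component by design (single-problem summit)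
set_option linter.dupNamespace false

namespace Summit.ValiantsHypothesis.ValiantsHypothesis.Theorems.RigidityForcesSymmetryRankRigidMinimalRepr

namespace LaplaceResidual

open Finset

/-- Five letters: two distinct ones have two further distinct companions and a fifth. -/
theorem exists_others_of_two : ∀ a x : Fin 5, a ≠ x → ∃ y z w : Fin 5,
    y ≠ a ∧ y ≠ x ∧ z ≠ a ∧ z ≠ x ∧ y ≠ z ∧ w ≠ a ∧ w ≠ x ∧ w ≠ y ∧ w ≠ z := by
  decide

/-- **LEMMA Z at a letter.**  `φ₀(a) = 0`, `φ₀(x) ≠ 0` for `x ≠ a`, all fibre sums of `(φ₀;φ₁;φ₂)` zero ⟹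
`φ₁(a)φ₂(x) + φ₁(x)φ₂(a) = 0` for all `x ≠ a`. -/
theorem lemmaZ_letter (φ₀ φ₁ φ₂ : Fin 5 → ℂ) (a : Fin 5) (h0a : φ₀ a = 0) (h0 : ∀ x, x ≠ a → φ₀ x ≠ 0)
    (hF : ∀ x y : Fin 5, x ≠ y →
      (∑ σ : Equiv.Perm (Fin 5), if σ 3 = x ∧ σ 4 = y then φ₀ (σ 0) * φ₁ (σ 1) * φ₂ (σ 2) else 0) = 0) :
    ∀ x : Fin 5, x ≠ a → φ₁ a * φ₂ x + φ₁ x * φ₂ a = 0 := by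
  intro x hxa
  obtain ⟨y, z, w, hya, hyx, hza, hzx, hyz, hwa, hwx, hwy, hwz⟩ := exists_others_of_two a x hxa.symm
  -- the triples {a,x,y} (complement {z,w}), {a,x,z} (complement {y,w}), {a,y,z} (complement {x,w})
  have E1 := hF z w hwz.symm
  rw [fibre_sum_eq φ₀ φ₁ φ₂ a x y z w hxa.symm hya.symm hza.symm hwa.symm hyx.symm hzx.symm hwx.symm hyz
    hwy.symm hwz.symm] at E1
  have E2 := hF y w hwy.symm
  rw [fibre_sum_eq φ₀ φ₁ φ₂ a x z y w hxa.symm hza.symm hya.symm hwa.symm hzx.symm hyx.symm hwx.symm hyz.symm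
    hwz.symm hwy.symm] at E2
  have E3 := hF x w hwx.symm
  rw [fibre_sum_eq φ₀ φ₁ φ₂ a y z x w hya.symm hza.symm hxa.symm hwa.symm hyz hyx hwy.symm hzx hwz.symm hwx.symm] at E3
  rw [h0a] at E1 E2 E3
  have key : 2 * (φ₀ y * φ₀ z) * (φ₁ a * φ₂ x + φ₁ x * φ₂ a) = 0 := by
    linear_combination (-1 : ℂ) * φ₀ x * E3 + φ₀ y * E2 + φ₀ z * E1
  have hnz : (2 : ℂ) * (φ₀ y * φ₀ z) ≠ 0 := mul_ne_zero (by norm_num) (mul_ne_zero (h0 y hya) (h0 z hza))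
  exact (mul_eq_zero.mp key).resolve_left hnz

/-- **The kernel is at most a line.**  Under the hypotheses of `lemmaZ_letter` and `φ₁(a) ≠ 0`: a covector `φ₂` with all
fibre sums zero is determined by its value at `a` — two such covectors are proportional, and one vanishing at `a` vanishes. -/
theorem kernel_line_letter (φ₀ φ₁ : Fin 5 → ℂ) (a : Fin 5) (h0a : φ₀ a = 0) (h0 : ∀ x, x ≠ a → φ₀ x ≠ 0)
    (h1a : φ₁ a ≠ 0) (φ₂ φ₂' : Fin 5 → ℂ)
    (hF : ∀ x y : Fin 5, x ≠ y →
      (∑ σ : Equiv.Perm (Fin 5), if σ 3 = x ∧ σ 4 = y then φ₀ (σ 0) * φ₁ (σ 1) * φ₂ (σ 2) else 0) = 0)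
    (hF' : ∀ x y : Fin 5, x ≠ y →
      (∑ σ : Equiv.Perm (Fin 5), if σ 3 = x ∧ σ 4 = y then φ₀ (σ 0) * φ₁ (σ 1) * φ₂' (σ 2) else 0) = 0) :
    (∀ c, φ₂' a * φ₂ c = φ₂ a * φ₂' c) ∧ (φ₂ a = 0 → φ₂ = 0) := by
  have hZ := lemmaZ_letter φ₀ φ₁ φ₂ a h0a h0 hF
  have hZ' := lemmaZ_letter φ₀ φ₁ φ₂' a h0a h0 hF'
  -- off `a`: φ₂ x = -φ₁ x φ₂ a / φ₁ a
  have hx : ∀ x, x ≠ a → φ₂ x = -(φ₁ x * φ₂ a) / φ₁ a := by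
    intro x hxa
    have := hZ x hxa
    field_simp
    linear_combination this
  have hx' : ∀ x, x ≠ a → φ₂' x = -(φ₁ x * φ₂' a) / φ₁ a := by
    intro x hxa
    have := hZ' x hxa
    field_simp
    linear_combination this
  constructor
  · intro c
    by_cases hca : c = a
    · rw [hca]; ring
    · rw [hx c hca, hx' c hca]; field_simp
  · intro h2a
    funext c
    by_cases hca : c = a
    · rw [hca, h2a]; rfl
    · rw [hx c hca, h2a]; simp

end LaplaceResidual

end Summit.ValiantsHypothesis.ValiantsHypothesis.Theorems.RigidityForcesSymmetryRankRigidMinimalRepr
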